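import Literature.NumberTheory.EllipticCurves.KellerYin2024.MultiplicativeReduction
import Literature.NumberTheory.EllipticCurves.KellerYin2024.AnomalousLambdaInvariants
import Literature.NumberTheory.EllipticCurves.IwasawaSelmer
import HarnessLib

/-!
# Keller–Yin (arXiv:2410.23241) §3 "Iwasawa theory … at primes of potentially ordinary reduction":
# Thm. 3.5.1 (anticyclotomic IMC for the Heegner pair of an elliptic curve), Thms. 3.3.6 + 3.4.4 (its
# Kolyvagin half), Thms. 2.4.1 + 3.6.1 (control), Thm. 3.7.1 at proof scope — PREPRINT CLAIMS (`_OPEN`)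
# — with the two notions their hypotheses need, and Thm. 2.5.1 (Kolyvagin) PROVED from the GZK fact

T. Keller, M. Yin, *`p`-converse theorems for elliptic curves of potentially good ordinary
reduction at Eisenstein primes*, arXiv:2410.23241 **v1** (2024-10-30; store text
`paper:arxiv-2410.23241`, 22 chunks; locators `[corpus:paper-arxiv-2410.23241 pNNNN:Lnn]` are
chunk:line). Sequel of `PotentiallyGoodOrdinaryPConverse.lean` (Thm. 0.1.2 = 3.7.1, `thm012_…`);
layout of the sibling `MultiplicativeReduction.lean` ([KY24] Thm. D: CGLS's — `v` induced by the
embedding datum, `𝔛` strict at `v̄`, `Char` along the structure map `j : ℤ_p → R₀`). Cell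
`bsd-littype` (D-0088(4)), seat `bsd-littype-06`. PRINT STATUS: unrefereed preprint (§0.9: "part
of MY's forthcoming Ph.D. thesis") resting on the preprint [KY24] and on an in-proof generalisation
of Jetchev–Loeffler–Zerbes 2021 (proof of Thm. 3.3.5, p0018): every fact below is
`[claim: KellerYin2024PotOrd, status: under-review]`, suffix `_OPEN`, no `_holds`.

## What §3 proves, and for which curves (dictionary "Case (I)" ↔ the tree)

§3.1 (p0013 L28–L43, p0015 L10): by Nekovář (Selmer complexes, 12.11.5 (iv)) the newform `f` of an
`E/ℚ` potentially ordinary at `p` is `f = f̃ ⊗ ε`, `f̃ ∈ S_2(Γ₀(N′), ε⁻²)` `p`-ordinary, `ε` of finite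
order; "Case I: … `f̃` has good reduction", "Case II: potentially multiplicative"; "From now on, we
assume `p ∤ N′`"; Thm. 3.5.1 is stated under "Case (I), i.e., `p ∤ N′`". For an elliptic curve:
`V_pE|_{G_{ℚ_p}}` has an unramified-by-finite quotient character `ψ₂`, ordinarity of `f ⊗ ε⁻¹` forces
`ε|_{I_p} = ψ₂|_{I_p}`, and the `p`-part of `N′` is `p^{a(ψ₂⁻²|_{I_p})}`; so `p ∤ N′` iff `ψ₂|_{I_p}²
= 1` iff `E` acquires good (ordinary) reduction over an extension of `ℚ_p` of degree `≤ 2` iff `E` or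
its twist `E^{(p*)}` has good ordinary reduction at `p` (semistability defect `e ≤ 2`; then `f̃ =
f_{E^{(p*)}}`, `ε = (·/p)`, `χ_ε = ε ∘ Nm_{K/ℚ}`, cond `ε = p`) = the predicate
`HasGoodOrdinaryReductionOverQuadraticAt` below (this seat's reading, = route `SchneiderFreeAdditiveX3`'s
"`p ∤ N′` ⟺ `e = 2`", cell `SubGordTwo`). CONSEQUENCE (Q-B1 of HOME/OPEN-QUESTIONS-06.md, a GAPPED row
for bsd-cited-lead): Thm. 3.7.1 = 0.1.2 is STATED for every prime of potentially good ordinary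
reduction, but its printed proof (via Thm. 3.5.1, p0021 L47) covers `e ≤ 2` only; at `e ∈ {3,4,6}`
(`p ≡ 1 mod e`) the pair has `p ‖ N′` (ramified principal series), outside Prop. 3.1.2 = [JLZ21,
Thm. B]. Partition vocabulary: §3 reaches `ClassX3 ∩ {e = 2, twist ordinary}` (and X1, where it is
[KY24]/[CGLS]); not potentially multiplicative X3 (§0.5), not potentially supersingular, not `e > 2`.

## Citation header (verbatim) and transcription

* Assumption 2.0.3 (p0008 L5–L11): "`p = v v̄` is split in `K`; … every prime `ℓ ∣ N` is split in
  `K`; the discriminant `D_K` of `K` is `< −3` and odd." → `IsImaginaryQuadratic K`, `primesOver …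
  ncard = 2`, `SatisfiesHeegnerHypothesis N K`, `Odd (discr K) ∧ discr K ≠ -3` (§3.1 p0014 L8 "prime
  divisors of `cond(ε)` split in `K`" is vacuous here: cond `ε = p`).
* §3.3 (p0017 L1–L8): "replacing `T_{f̃}` by a different Galois stable lattice if necessary, we
  assume that `φ|_{G_p} ≠ 𝟙` in `0 → 𝔽(φ) → ρ̄_{f̃} ⊗ ε → 𝔽(ψ) → 0` where `G_p ⊂ G_K` is the
  decomposition group at `p` … A consequence of this assumption is that `H⁰(K, ρ̄_{f̃} ⊗ ε) = 0`."
  (`ρ̄_{f̃} ⊗ ε = E[p]`) → `Red W p`, `∃ Φ, IsRationalLine W p Φ ∧ ¬ LineDecompositionTrivialAt W p Φ`,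
  and — kept as printed in Thms. 3.3.6/3.4.4/3.5.1 — `E(K)[p] = 0`.
* Def. 3.4.1 (p0019 L19–L27): `𝔛` = Pontryagin dual of `ker{H¹(K^Σ/K, M_ε) → ∏_{w∈Σ, w∤p}
  H¹(K_w, M_ε) × H¹(K_{v̄}, M_ε)}`, `M_ε = T_ε ⊗ Λ^∨`; §3.6 (p0020 L50): "when `E` is an elliptic
  curve, we have `T_ε = T_pE` … `A_ε = E[p^∞]`". → Castella's `Λ`-dual `AcSelmer.XAc (W.baseChange K)
  p κ vbar ∅ γ` (strict at `v̄` and at every `w ∤ p`, relaxed at `v`; "Castella's `𝔭` = CGLS's `v̄`"),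
  `Λ = IwasawaAlgebra p` (`1 + T ↔ γ`), `κ` anticyclotomic; `μ`, `λ` = `muInvariant`, `lambdaInvariant`.
* §3.4 (p0019 L35–L40): "there is a BDP `p`-adic `L`-function `𝓛_ε := 𝓛_p(f̃)(χ_ε)` … when
  `f = f̃ ⊗ ε`, from the interpolation property ([BDP13]), there is a relation `𝓛_p(f̃, χ_ε(·)) =
  𝓛_p(f, ·)`." TRANSPORT CLAUSE (flag KYb-frame): the tree has no nebentypus forms and no `χ`-branch
  object, so `𝓛_ε` is read, per this display, on Castella-shape frames of the newform `f` of `E` —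
  `L ∈ R₀⟦T⟧` with `IsBDPLFunction ι' v κ γ f Ω_K Ω_p L` (Euler-type factor `1` at `p² ∣ N`) for SOME
  `Ω_K ∈ ℂ^×`, `Ω_p ∈ ℂ_p^×` (NOT required to be a unit: Castella–Hsieh's multiplier `ε(½,·)^{-2}` on
  the ramified `χ_ε`-branch rescales the `p`-adic period; route `SchneiderFreeAdditiveX3`, finding
  F3). Any such frame interpolates the same central values `L(f/K, ξ, 1) = L(f̃/K, χ_ε ξ, 1)` as
  `𝓛_ε`, hence lies in `p^ℤ · R₀⟦T⟧^× · 𝓛_ε` when it exists; the statements below are UNIVERSAL over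
  frames and INVARIANT under `p^ℤ · R₀⟦T⟧^×` (slack `c`/`k`; `λ`, "`μ = 0`" via `FirstUnitCoeffAt`),
  so they follow from print for every frame and are vacuous if none exists (existence at `p² ∣ N`
  is NOT asserted: it is the route hypothesis `SchneiderFree.BranchBDPExistsAt`; `c = 0` is Q-B2).
* **Theorem 3.3.6** (p0019 L8–L15) ∘ **Proposition 3.4.4** (p0019 L57–p0020 L3; (HPMC) ⟹ (GrMC),
  "`𝔛` [is] `Λ`-torsion, and the divisibility `Char_Λ(𝔛)Λ^nr ⊃ (𝓛_ε)` holds in `Λ^nr`") →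
  `thm336_oneSided_isTorsion_mem_charIdeal_OPEN` (verbatim text in its docstring).
* **Theorem 3.5.1** (p0020 L23–L34; "`μ(𝔛) = μ(𝓛_ε) = 0` and `λ(𝔛) = λ(𝓛_ε)`. Consequently,
  `Char_Λ(𝔛)Λ^ur = (𝓛_ε)`"; proof §3.5 p0020 L5–L21 via Kriz's congruences, Katz `𝓛_{φε}`, "the
  same arguments in [CGLS]", Rubin 1991 + CW78; Rem. 3.5.2) → `thm351_imc_isTorsion_mu_zero_charIdeal_eq_OPEN`
  (Greenberg form; the HPMC form needs `Λ`-adic Heegner classes, not in the tree).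
* **Theorem 2.4.1** (p0012 L22–L26) + **Theorem 3.6.1** (p0020 L48–L49) → `thm361_anticyclotomicControl_OPEN`
  (Mazur's `WeierstrassCurve.selmer_control` vocabulary; the potentially multiplicative clause p0021
  L36 is not transcribed).
* **Theorem 2.5.1** (Kolyvagin; p0012 L50–L53) → PROVED, `thm251_selmerCorank_eq_of_analyticRank_eq`.
* **Theorem 3.7.1** (= 0.1.2; p0021 L39–L47) READ AT THE SCOPE OF ITS PRINTED PROOF (Case (I),
  `e ≤ 2`) → `thm371_pConverse_caseOne_OPEN` (§7), implied by the verbatim binder `thm012_…`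
  (`thm371_caseOne_OPEN_of_thm012`); the difference between the two is exactly Q1 (Q-B1).

## NOT typed (no tree vocabulary / not about `E`; reasons on the LOCATOR sheet): Conj. 3.3.1, Thms.
3.3.4–3.3.5, 3.4.3 (Kolyvagin systems, `Λ`-adic Heegner classes, regulator map), Prop. 3.2.3, Prop.
3.1.3 / Thm. 3.1.1 (nebentypus forms), Prop. 1.4.1, Lemma 1.4.2, Cor. 3.8.1, Conj. 0.1.1 (a conjecture:
`Summits/`, not Literature). Thm. 3.7.1 = 0.1.2 AS STATED is `thm012_…` (sibling file).

## References
[KellerYin2024PotOrd] arXiv:2410.23241v1 (locators above); [KellerYin2024] arXiv:2402.12781;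
[CastellaGrossiLeeSkinner2022] Prop. 4.2.1, proof of Thm. 4.2.2 (layout); [Castella2018] Def. 2.2,
Thm. 3.1; [CastellaHsieh2018] Def. 3.5 / Prop. 3.6; [JetchevLoefflerZerbes2021] Thm. B;
[GreenbergLNM1716] Thms. 1.2, 2.4; [Darmon2004] Thm. 3.22 (GZK); Nekovář, Astérisque 310, 12.11.5.
-/

noncomputable section

open scoped Classical NumberField

open PowerSeries WeierstrassCurve NumberField IsDedekindDomain Field
  Literature.NumberTheory.EllipticCurves Literature.NumberTheory.EllipticCurves.ModularForms
  Literature.NumberTheory.QuadraticFields Literature.NumberTheory.EllipticCurves.Rank1Residual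
  Literature.NumberTheory.EllipticCurves.Castella2018
  Literature.NumberTheory.GaloisRepresentations

/-! ### §0 The two notions the hypotheses need -/

namespace WeierstrassCurve

/-- `W.HasGoodOrdinaryReductionOverQuadraticAt p` — **Keller–Yin's "Case (I)" for an elliptic
curve**: `E = W/ℚ` acquires GOOD ORDINARY reduction at some place `w ∣ p` of a number field `F` of
degree `≤ 2` over `ℚ` (`F = ℚ`: good ordinary reduction at `p`; `F` quadratic: e.g. the field cut
out by `(·/p)`, i.e. the quadratic twist `E^{(p*)}` has good ordinary reduction at `p`) — good
reduction `HasGoodReductionAt w` of `E_F` with the unit-root condition `HasUnitRootAt w`, exactly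
the atoms of `HasPotentiallyGoodOrdinaryReductionAtPrime` (which it implies,
`hasPotentiallyGoodOrdinaryReductionAtPrime_of_overQuadratic`) plus `[F : ℚ] ≤ 2` = "`f = f̃ ⊗ ε`,
`f̃` `p`-ordinary of level `N′`, `p ∤ N′`" (§3.1 Case (I), p0013 L35, p0015 L10; `e ≤ 2`). A definition.
[cite: SilvermanAEC2009, VII.5 Definition p. 197 (potential good reduction) with V.3 Definition (ordinary); Keller–Yin arXiv:2410.23241 §3.1 Case (I) (the case it transcribes)] -/
def HasGoodOrdinaryReductionOverQuadraticAt (W : WeierstrassCurve ℚ) (p : ℕ) : Prop :=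
  ∃ (F : Type) (_ : Field F) (_ : NumberField F) (w : HeightOneSpectrum (𝓞 F)),
    Module.finrank ℚ F ≤ 2 ∧ (p : 𝓞 F) ∈ w.asIdeal ∧
      (W.baseChange F).HasGoodReductionAt w ∧ (W.baseChange F).HasUnitRootAt w

variable (W : WeierstrassCurve ℚ) (p : ℕ)

/-- **Case (I) is a case of potentially good ordinary reduction** (forget the degree bound): the
hypothesis of Thm. 3.5.1 implies that of Thm. 0.1.2 (`thm012_…`). [cite: SilvermanAEC2009, VII.5 Definition p. 197] -/
theorem hasPotentiallyGoodOrdinaryReductionAtPrime_of_overQuadratic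
    (h : W.HasGoodOrdinaryReductionOverQuadraticAt p) :
    W.HasPotentiallyGoodOrdinaryReductionAtPrime p := by
  obtain ⟨F, _, _, w, _, hw, hgood, hunit⟩ := h
  exact ⟨F, inferInstance, inferInstance, w, hw, hgood, hunit⟩

/-- Base change of `W/ℚ` to `ℚ` along ANY `ℚ`-algebra structure on `ℚ` is `W`. [folklore] -/
private theorem baseChange_rat_eq' (inst : Algebra ℚ ℚ) :
    @WeierstrassCurve.baseChange ℚ _ W ℚ _ inst = W := by
  rw [WeierstrassCurve.baseChange, Subsingleton.elim (@algebraMap ℚ ℚ _ _ inst) (RingHom.id ℚ), map_id]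

/-- **Good ordinary reduction at `p` is Case (I)** (`F = ℚ`): for a globally minimal elliptic `W/ℚ`,
`p ∤ N` and `p ∤ a_p` (`GoodOrd W p`) give the predicate (tree bridge
`hasGoodReductionAt_and_hasUnitRootAt_of_rat`, Greenberg LNM 1716 Thm. 1.2, §4) — so Thm. 3.5.1
contains the good ordinary Eisenstein case of [KY24]/[CGLS]. [cite: GreenbergLNM1716, Thm 1.2 and §4 p. 103] -/
theorem hasGoodOrdinaryReductionOverQuadraticAt_of_goodOrd [W.IsElliptic] [W.IsGloballyMinimal]
    [Fact p.Prime] (h : GoodOrd W p) : W.HasGoodOrdinaryReductionOverQuadraticAt p := by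
  set v : HeightOneSpectrum (𝓞 ℚ) := Rat.HeightOneSpectrum.primesEquiv.symm ⟨p, Fact.out⟩ with hv_def
  have hgen : Rat.HeightOneSpectrum.natGenerator v = p := by
    change ((Rat.HeightOneSpectrum.primesEquiv v : Nat.Primes) : ℕ) = p
    rw [hv_def, Equiv.apply_symm_apply]
  have hv : (p : 𝓞 ℚ) ∈ v.asIdeal := by
    simpa only [hgen] using Rat.HeightOneSpectrum.natCast_natGenerator_mem v
  refine ⟨ℚ, inferInstance, inferInstance, v, by rw [Module.finrank_self]; omega, hv, ?_⟩
  rw [baseChange_rat_eq']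
  exact W.hasGoodReductionAt_and_hasUnitRootAt_of_rat h.1 h.2 v hv

end WeierstrassCurve

namespace Literature.NumberTheory.EllipticCurves.KellerYin2024

/-- `LineDecompositionTrivialAt W p Φ`: the kernel character of the rational `p`-line `Φ ≤ E[p]`
is **trivial on the decomposition groups at `p`** — every `σ` in the decomposition subgroup
`D_𝔓 = Stab(𝔓) ≤ Γ_ℚ` (tree `Ideal.decompositionSubgroup`) of every prime `𝔓` of `ℤ̄` above `p`
fixes `Φ` pointwise; Keller–Yin's "`φ|_{G_p} = 𝟙`" (§3.3, p0017 L1–L4), the condition their lattice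
normalisation EXCLUDES; implies `Rank1Residual.LineUnramifiedAt` (`…lineUnramifiedAt`). A definition.
[cite: GreenbergVatsal2000, Thm. 1.3 (the kernel character of Φ restricted at p; shape)] -/
def LineDecompositionTrivialAt (W : WeierstrassCurve ℚ) (p : ℕ) [Fact p.Prime]
    (Φ : AddSubgroup (geomTorsion W (p : ℤ))) : Prop :=
  ∀ v : HeightOneSpectrum (𝓞 ℚ), (p : 𝓞 ℚ) ∈ v.asIdeal →
    ∀ 𝔓 ∈ v.primesAbove, ∀ σ ∈ 𝔓.decompositionSubgroup (absoluteGaloisGroup ℚ), ∀ P ∈ Φ, σ • P = P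

/-- A line on which the decomposition groups at `p` act trivially is unramified at `p` (`I_𝔓 ≤
D_𝔓`); contrapositively, [KY24]'s normalisation "no rational line unramified at `p`" implies KY24b's
"`φ|_{G_p} ≠ 𝟙`" for every rational line. [cite: GreenbergVatsal2000, Thm. 1.3 (shape)] -/
theorem LineDecompositionTrivialAt.lineUnramifiedAt {W : WeierstrassCurve ℚ} {p : ℕ} [Fact p.Prime]
    {Φ : AddSubgroup (geomTorsion W (p : ℤ))} (h : LineDecompositionTrivialAt W p Φ) :
    LineUnramifiedAt W p Φ :=
  fun v hv 𝔓 h𝔓 σ hσ P hP ↦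
    h v hv 𝔓 h𝔓 σ (Ideal.inertia_le_decompositionSubgroup (absoluteGaloisGroup ℚ) 𝔓 hσ) P hP

/-! ### §1 The standing data of §3 for the Heegner pair of an elliptic curve (a `Prop`-structure) -/

/-- **The hypotheses of Keller–Yin §3 (Thms. 3.3.6, 3.4.4, 3.5.1) for the Heegner pair
`(f̃, χ_ε)` of an elliptic curve `E = W/ℚ`, transcribed** (module docstring, citation header):
`f` the newform of `W` has level `N = N_E` (`level`); "`p > 2`" (`two_lt`); "Case (I), i.e.
`p ∤ N′`" (`caseOne`, = `HasGoodOrdinaryReductionOverQuadraticAt`); Eisenstein: "`E[p]` is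
reducible" (`red`) with the lattice normalisation "`φ|_{G_p} ≠ 𝟙`" for some rational line
(`lattice`) and "`H⁰(K, ρ̄_{f̃} ⊗ ε) = 0`", i.e. `E(K)[p] = 0` (`torsionFree`); Assumption 2.0.3:
`K` imaginary quadratic (`imagQuad`), Heegner hypothesis for `N` (`heegner`), `D_K` odd and `≠ −3`
(`odd`, `ne_neg_three`), `p = v v̄` split (`split`) with `v` the prime induced by the embedding
datum `ι' : ℚ̄_p ≃ ℂ` (`induces`, the clause of `castella2018_exists_isBDPLFunction`) and `v̄ ∋ p`
the other one (`mem_vbar`, `vbar_ne`); `κ` THE anticyclotomic `ℤ_p`-extension (`anticyclotomic`).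
A conjunction of hypotheses (nothing asserted; layout of the sibling `ThmBHypotheses`).
[claim: KellerYin2024PotOrd, status: under-review] -/
structure PotOrdSetting {p : ℕ} [Fact p.Prime] (ι' : PadicAlgCl p ≃+* ℂ) (W : WeierstrassCurve ℚ)
    [W.IsElliptic] [W.IsGloballyMinimal] (K : Type) [Field K] [NumberField K]
    (v vbar : HeightOneSpectrum (𝓞 K)) (κ : ZpExtension K p) (N : ℕ) : Prop where
  level : W.conductorNorm ℤ = N
  two_lt : 2 < p
  caseOne : W.HasGoodOrdinaryReductionOverQuadraticAt p
  red : Red W p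
  lattice : ∃ Φ : AddSubgroup (geomTorsion W (p : ℤ)),
    IsRationalLine W p Φ ∧ ¬ LineDecompositionTrivialAt W p Φ
  torsionFree : ∀ Q : (W.baseChange K).toAffine.Point, p • Q = 0 → Q = 0
  imagQuad : IsImaginaryQuadratic K
  heegner : SatisfiesHeegnerHypothesis N K
  odd : Odd (NumberField.discr K)
  ne_neg_three : NumberField.discr K ≠ -3
  split : ((Ideal.span {(p : ℤ)}).primesOver (𝓞 K)).ncard = 2
  induces : ∀ (w : InfinitePlace K) (k : 𝓞 K), k ∈ v.asIdeal ↔ ‖ι'.symm (w.embedding (k : K))‖ < 1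
  mem_vbar : ((p : ℕ) : 𝓞 K) ∈ vbar.asIdeal
  vbar_ne : vbar ≠ v
  anticyclotomic : κ.IsAnticyclotomic

/-! ### §2 Thm. 3.3.6 + Prop. 3.4.4: the one-sided (Kolyvagin) divisibility — OPEN fact -/

/-- **OPEN HYPOTHESIS — UNREFEREED PREPRINT (Keller–Yin, arXiv:2410.23241v1), Theorem 3.3.6
composed with Proposition 3.4.4 ((HPMC) ⟹ (GrMC), divisibility "⊃"), for the Heegner pair of an
elliptic curve.** Thm. 3.3.6 (p0019 L8–L15): "Assume `p > 2` and that `p ∤ N′`. Assume that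
`H⁰(K, ρ̄_{f̃} ⊗ ε) = 0`. Then `H¹_{𝓕_{Λ,ε}}(K, 𝐓_ε)` has `Λ`-rank one, and there is a finitely
generated torsion `Λ`-module `M` such that (i) `𝒳 ∼ Λ ⊕ M ⊕ M`, (ii) `Char_Λ(M)` divides
`Char_Λ(H¹_{𝓕_{Λ,ε}}(K, 𝐓_ε)/Λκ₁)`"; Prop. 3.4.4 (p0019 L57–p0020 L3, "`p = v v̄` splits in `K` …
`p ∤ N′` … `H⁰ = 0`"): (HPMC) ⟺ "(GrMC) Both `H¹_{𝓕_Gr}(K, 𝐓_ε)` and `𝔛 = H¹_{𝓕_Gr}(K, M_ε)^∨` are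
`Λ`-torsion, and the divisibility `Char_Λ(𝔛)Λ^nr ⊃ (𝓛_ε)` holds in `Λ^nr`". TRANSCRIBED under
`PotOrdSetting`: `𝔛 = AcSelmer.XAc (W.baseChange K) p κ vbar ∅ γ` is `Λ`-torsion, and for EVERY
Castella-shape frame `(Ω_K ≠ 0, Ω_p ≠ 0, L)` of the newform `f` of `E` (TRANSPORT CLAUSE, flag
KYb-frame; vacuous if no frame exists) and THE structure map `j : ℤ_p → R₀`: `p^k · L ∈
Char_Λ(𝔛)·R₀⟦T⟧` for some `k` — the currency of the published good-reduction twin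
`CastellaGrossiLeeSkinner2022.proofThm422_exists_isBDPLFunction_isTorsion_charIdeal_dvd`. Printed
proof: Kolyvagin system of the pair (Thm. 3.3.5, an in-proof generalisation of [JLZ21] + [LV] + [KY24]),
Howard's argument twisted by `ε` (3.3.2–3.3.4), reciprocity law Thm. 3.4.3 ([JLZ21, Thm. B]). Implied by
`thm351_…` (`thm336_OPEN_of_thm351_OPEN`). NEVER cite this `Prop` as a theorem. [claim: KellerYin2024PotOrd, status: under-review]
[cite: CastellaGrossiLeeSkinner2022, Prop. 4.2.1 and proof of Thm. 4.2.2 (the published `p ∤ N` twin; currency)] -/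
def thm336_oneSided_isTorsion_mem_charIdeal_OPEN : Prop :=
  ∀ {p : ℕ} [Fact p.Prime] (ι' : PadicAlgCl p ≃+* ℂ) (W : WeierstrassCurve ℚ) [W.IsElliptic]
    [W.IsGloballyMinimal] (K : Type) [Field K] [NumberField K] (v vbar : HeightOneSpectrum (𝓞 K))
    (κ : ZpExtension K p) (γ : absoluteGaloisGroup K) [Fact (κ.IsTopGenerator γ)] {N : ℕ} [NeZero N]
    {f : CuspForm (CongruenceSubgroup.Gamma0 N) 2} (_ : IsNewformOf W f),
    PotOrdSetting ι' W K v vbar κ N →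
    Module.IsTorsion (IwasawaAlgebra p) (AcSelmer.XAc (W.baseChange K) p κ vbar ∅ γ) ∧
    ∀ (ΩK : ℂ) (Ωp : ℂ_[p]) (L : UnrSeries p), ΩK ≠ 0 → Ωp ≠ 0 →
      IsBDPLFunction ι' v κ γ f ΩK Ωp L →
      ∀ (j : ℤ_[p] →+* unrIntegers p),
        (∀ x : ℤ_[p], ((j x : unrIntegers p) : ℂ_[p]) = algebraMap ℚ_[p] ℂ_[p] (x : ℚ_[p])) →
        ∃ k : ℕ, C ((p : unrIntegers p) ^ k) * L ∈
          (AcSelmer.XAc.charIdeal (W.baseChange K) p κ vbar ∅ γ).map (PowerSeries.map j)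

/-! ### §3 Thm. 3.5.1: the anticyclotomic main conjecture for the Heegner pair — OPEN fact -/

/-- **OPEN HYPOTHESIS — UNREFEREED PREPRINT (Keller–Yin, arXiv:2410.23241v1), Theorem 3.5.1
(label (IMCpo): the anticyclotomic IMC at a potentially good ordinary Eisenstein prime, PROVED there,
Greenberg form), for the Heegner pair of an elliptic curve.** Verbatim (p0020 L23–L34): "Assume we are in
Case (I) of (twists), i.e., `p ∤ N′`. Assume that `p = v v̄` splits in `K`. Assume that
`H⁰(K, ρ̄_{f̃} ⊗ ε) = 0`. Then `μ(𝔛) = μ(𝓛_ε) = 0` and `λ(𝔛) = λ(𝓛_ε)`. Consequently,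
`Char_Λ(𝔛)Λ^ur = (𝓛_ε)` holds in `Λ^ur`". TRANSCRIBED under `PotOrdSetting` (standing hypotheses,
Eisenstein setting of §3.5 and lattice normalisation of §3.3 included): (i) `𝔛 = AcSelmer.XAc
(W.baseChange K) p κ vbar ∅ γ` is `Λ`-torsion [from (GrMC)]; (ii) `μ(𝔛) = 0` (`muInvariant`); (iii)
for EVERY Castella-shape frame `(Ω_K ≠ 0, Ω_p ≠ 0, L)` of the newform `f` of `E` and THE structure
map `j`: `L = p^c · L₀` with `μ(L₀) = 0`, `λ(L₀) = λ(𝔛)` (`FirstUnitCoeffAt L₀ (lambdaInvariant p 𝔛)`)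
and `Char_Λ(𝔛)·R₀⟦T⟧ = (L₀)` — (i)(ii) VERBATIM (specialised to `E`), (iii) the printed
"`μ(𝓛_ε) = 0`, `λ(𝓛_ε) = λ(𝔛)`, `Char_Λ(𝔛)Λ^ur = (𝓛_ε)`" under the TRANSPORT CLAUSE (flag
KYb-frame): invariant under `L ↦ p^c·u·L`, hence implied by print for every frame, vacuous if none
exists; `c = 0` iff the frame has `μ = 0` (`charIdeal_map_eq_span_of_thm351_OPEN_of_not_dvd`; Q-B2).
SCOPE: `e ≤ 2` (Q-B1). Printed proof: Thms. 3.3.6 + 3.4.4, then §3.5 (Kriz's congruences, Rubin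
1991) "as in [KY24]". NEVER cite this `Prop` as a theorem; conditional on two preprint layers.
[claim: KellerYin2024PotOrd, status: under-review]
[cite: CastellaGrossiLeeSkinner2022, Thm. 4.2.2 with Thm. 2.2.3 (the published non-anomalous `p ∤ N` twin; shape)] -/
def thm351_imc_isTorsion_mu_zero_charIdeal_eq_OPEN : Prop :=
  ∀ {p : ℕ} [Fact p.Prime] (ι' : PadicAlgCl p ≃+* ℂ) (W : WeierstrassCurve ℚ) [W.IsElliptic]
    [W.IsGloballyMinimal] (K : Type) [Field K] [NumberField K] (v vbar : HeightOneSpectrum (𝓞 K))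
    (κ : ZpExtension K p) (γ : absoluteGaloisGroup K) [Fact (κ.IsTopGenerator γ)] {N : ℕ} [NeZero N]
    {f : CuspForm (CongruenceSubgroup.Gamma0 N) 2} (_ : IsNewformOf W f),
    PotOrdSetting ι' W K v vbar κ N →
    Module.IsTorsion (IwasawaAlgebra p) (AcSelmer.XAc (W.baseChange K) p κ vbar ∅ γ) ∧
    muInvariant p (AcSelmer.XAc (W.baseChange K) p κ vbar ∅ γ) = 0 ∧
    ∀ (ΩK : ℂ) (Ωp : ℂ_[p]) (L : UnrSeries p), ΩK ≠ 0 → Ωp ≠ 0 →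
      IsBDPLFunction ι' v κ γ f ΩK Ωp L →
      ∀ (j : ℤ_[p] →+* unrIntegers p),
        (∀ x : ℤ_[p], ((j x : unrIntegers p) : ℂ_[p]) = algebraMap ℚ_[p] ℂ_[p] (x : ℚ_[p])) →
        ∃ (c : ℕ) (L₀ : UnrSeries p), L = C ((p : unrIntegers p) ^ c) * L₀ ∧
          FirstUnitCoeffAt L₀ (lambdaInvariant p (AcSelmer.XAc (W.baseChange K) p κ vbar ∅ γ)) ∧
          (AcSelmer.XAc.charIdeal (W.baseChange K) p κ vbar ∅ γ).map (PowerSeries.map j) =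
            Ideal.span {L₀}

/-! ### §4 Proved API: Thm. 3.5.1 ⟹ Thm. 3.3.6's divisibility; the door direction when `μ(L) = 0` -/

/-- **Thm. 3.5.1 (equality) implies Thm. 3.3.6 + Prop. 3.4.4 (Kolyvagin divisibility)**: `L = p^c L₀ ∈
(L₀) = Char_Λ(𝔛)·R₀⟦T⟧`, so `k = 0`. Bookkeeping; nothing asserted. [claim: KellerYin2024PotOrd, status: under-review] -/
theorem thm336_OPEN_of_thm351_OPEN (h : thm351_imc_isTorsion_mu_zero_charIdeal_eq_OPEN) :
    thm336_oneSided_isTorsion_mem_charIdeal_OPEN := by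
  intro p _ ι' W _ _ K _ _ v vbar κ γ _ N _ f hf hS
  obtain ⟨hT, -, hfr⟩ := h ι' W K v vbar κ γ hf hS
  refine ⟨hT, fun ΩK Ωp L hΩK hΩp hL j hj ↦ ⟨0, ?_⟩⟩
  obtain ⟨c, L₀, hLL₀, -, hspan⟩ := hfr ΩK Ωp L hΩK hΩp hL j hj
  rw [hspan, pow_zero, map_one, one_mul, hLL₀]
  exact Ideal.mem_span_singleton.mpr (Dvd.intro_left _ rfl)

/-- **The door direction from Thm. 3.5.1 when the frame has `μ = 0`**: if `p ∤ L` in `R₀⟦T⟧` then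
the slack is `c = 0`, `L = L₀`, and `Char_Λ(𝔛)·R₀⟦T⟧ = (L)` — in particular `Char_Λ(𝔛)·R₀⟦T⟧ ⊆ (L)`,
the shape of route `SchneiderFreeAdditiveX3`'s hypothesis `BranchIMCDivAt` at such a frame.
CONDITIONAL on the OPEN fact; nothing asserted. [claim: KellerYin2024PotOrd, status: under-review] -/
theorem charIdeal_map_eq_span_of_thm351_OPEN_of_not_dvd
    (h : thm351_imc_isTorsion_mu_zero_charIdeal_eq_OPEN)
    {p : ℕ} [Fact p.Prime] (ι' : PadicAlgCl p ≃+* ℂ) (W : WeierstrassCurve ℚ) [W.IsElliptic]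
    [W.IsGloballyMinimal] (K : Type) [Field K] [NumberField K] (v vbar : HeightOneSpectrum (𝓞 K))
    (κ : ZpExtension K p) (γ : absoluteGaloisGroup K) [Fact (κ.IsTopGenerator γ)] {N : ℕ} [NeZero N]
    {f : CuspForm (CongruenceSubgroup.Gamma0 N) 2} (hf : IsNewformOf W f)
    (hS : PotOrdSetting ι' W K v vbar κ N) {ΩK : ℂ} {Ωp : ℂ_[p]} {L : UnrSeries p} (hΩK : ΩK ≠ 0)
    (hΩp : Ωp ≠ 0) (hL : IsBDPLFunction ι' v κ γ f ΩK Ωp L) (hμ : ¬ C (p : unrIntegers p) ∣ L)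
    (j : ℤ_[p] →+* unrIntegers p)
    (hj : ∀ x : ℤ_[p], ((j x : unrIntegers p) : ℂ_[p]) = algebraMap ℚ_[p] ℂ_[p] (x : ℚ_[p])) :
    (AcSelmer.XAc.charIdeal (W.baseChange K) p κ vbar ∅ γ).map (PowerSeries.map j) =
      Ideal.span {L} := by
  obtain ⟨-, -, hfr⟩ := h ι' W K v vbar κ γ hf hS
  obtain ⟨c, L₀, hLL₀, -, hspan⟩ := hfr ΩK Ωp L hΩK hΩp hL j hj
  rcases Nat.eq_zero_or_pos c with rfl | hc
  · rw [hspan, hLL₀, pow_zero, map_one, one_mul]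
  · exfalso
    refine hμ ⟨C ((p : unrIntegers p) ^ (c - 1)) * L₀, ?_⟩
    rw [hLL₀, ← mul_assoc, ← map_mul, ← pow_succ', Nat.sub_add_cancel hc]

/-! ### §5 Thm. 2.4.1 + Thm. 3.6.1: the anticyclotomic control theorem — OPEN fact -/

/-- **OPEN HYPOTHESIS — UNREFEREED PREPRINT (Keller–Yin, arXiv:2410.23241v1), Theorem 2.4.1 (good
ordinary) + Theorem 3.6.1 "Control theorem" (potentially good ordinary but not ordinary).**
Verbatim (p0012 L22–L26): "Let `E/ℚ` be an elliptic curve which has good, ordinary reduction at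
`p`, then the map `Sel_{p^∞}(E/K) → Sel_{p^∞}(E/K_∞)^Γ` has finite kernel and cokernel"; (p0020
L48–L49): "in the potentially good ordinary but not ordinary case, `ker(r_v)` and `ker(r_{v̄})` are
finite", whence (§3.6 ¶1) the same control statement; `K` as in Assumption 2.0.3, `K_∞/K` THE
anticyclotomic `ℤ_p`-extension, `p ≥ 3` (the paper's frame). TRANSCRIBED in the vocabulary of
Mazur's `WeierstrassCurve.selmer_control` at the layer `n = 0` (`K_0 = K`): for `E_K = W.baseChange K`
the kernel of the restriction `layerToInfty κ 0` on `Sel_{p^∞}(E/K) = selmerLayer κ 0` is finite, and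
`Sel_{p^∞}(E/K_∞)^Γ = selmerInfty κ ⊓ layerInvariants κ 0` modulo the image of `Sel_{p^∞}(E/K)` is
finite; hypotheses `2 < p`, `HasPotentiallyGoodOrdinaryReductionAtPrime` (good ordinary INCLUDED; no
`e ≤ 2` restriction — the printed proof of 3.6.1 does not use `p ∤ N′`), `K` imaginary quadratic with
`p` split, Heegner hypothesis for `N_E`, `D_K` odd `≠ −3`, `κ.IsAnticyclotomic` (only (spl) is used by
the proof; the rest is the standing Assumption 2.0.3, kept). The potentially multiplicative clause
(p0021 L36) is not transcribed. Printed proof: [JSW2017] at `w ∤ p`, [Greenberg1999, Thm. 2.4] at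
`v, v̄` over an extension `L_u` trivialising `ε`. NEVER cite this `Prop` as a theorem.
[claim: KellerYin2024PotOrd, status: under-review]
[cite: GreenbergLNM1716, Thm 1.2 (Mazur's control theorem; the statement shape `selmer_control`)] -/
def thm361_anticyclotomicControl_OPEN : Prop :=
  ∀ (W : WeierstrassCurve ℚ) [W.IsElliptic] [W.IsGloballyMinimal] (p : ℕ) [Fact p.Prime]
    (K : Type) [Field K] [NumberField K] (κ : ZpExtension K p),
    2 < p → W.HasPotentiallyGoodOrdinaryReductionAtPrime p →
    IsImaginaryQuadratic K → ((Ideal.span {(p : ℤ)}).primesOver (𝓞 K)).ncard = 2 →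
    SatisfiesHeegnerHypothesis (W.conductorNorm ℤ) K → Odd (NumberField.discr K) →
      NumberField.discr K ≠ -3 →
    κ.IsAnticyclotomic →
    Finite ↥(((W.baseChange K).layerToInfty κ 0).ker ⊓ (W.baseChange K).selmerLayer κ 0) ∧
      Finite (↥((W.baseChange K).selmerInfty κ ⊓ (W.baseChange K).layerInvariants κ 0) ⧸
        (((W.baseChange K).selmerLayer κ 0).map ((W.baseChange K).layerToInfty κ 0)).addSubgroupOf
          ((W.baseChange K).selmerInfty κ ⊓ (W.baseChange K).layerInvariants κ 0))

/-! ### §6 Thm. 2.5.1 (Kolyvagin) — PROVED from the tree's Gross–Zagier–Kolyvagin fact -/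

/-- **Keller–Yin Thm. 2.5.1 (Kolyvagin)** (p0012 L50–L53): "Let `E/ℚ` be an elliptic curve and `p`
be a prime. Let `r ∈ {0,1}`. Then `ord_{s=1} L(E/ℚ,s) = r ⟹ corank_{ℤ_p} Sel_{p^∞}(E/ℚ) = r`."
PROVED from the tree's GZK fact `rank_eq_analyticRank_of_analyticRank_le_one` and the tree THEOREM
`selmerCorank_eq_mordellWeilRank_of_finite_shaPrimary` (`corank Sel_{p^∞} = rank + corank Ш[p^∞]`),
i.e. the exact sequence (iii) ⇐ (ii) of §0.1. [cite: Darmon2004, Thm. 3.22 (= Thm. 1.14) (Gross–Zagier–Kolyvagin)] -/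
theorem thm251_selmerCorank_eq_of_analyticRank_eq (hGZK : rank_eq_analyticRank_of_analyticRank_le_one)
    (W : WeierstrassCurve ℚ) [W.IsElliptic] (p : ℕ) [Fact p.Prime] {r : ℕ} (hr : r = 0 ∨ r = 1)
    (hra : W.analyticRank = r) : W.selmerCorank p = r := by
  obtain ⟨hrk, hfin⟩ := hGZK W (by rcases hr with rfl | rfl <;> omega)
  haveI : Finite W.sha := hfin
  exact (selmerCorank_eq_mordellWeilRank_of_finite_shaPrimary W p inferInstance).trans (hrk.trans hra)

/-! ### §7 Thm. 3.7.1 at the scope of its printed proof (Case (I), `e ≤ 2`) — OPEN fact -/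

/-- **OPEN HYPOTHESIS — UNREFEREED PREPRINT (Keller–Yin, arXiv:2410.23241v1), Theorem 3.7.1 (= Thm.
0.1.2) READ AT THE SCOPE OF ITS PRINTED PROOF.** Verbatim (p0021 L39–L47): "Let `E` be an elliptic
curve defined over `ℚ` and let `p > 2` be a prime of potentially good ordinary reduction for `E`.
Assume that `E[p]` is reducible. Let `r ∈ {0,1}`. Then `corank_{ℤ_p} Sel_{p^∞}(E/ℚ) = r ⟹
ord_{s=1} L(E,s) = r`"; proof: "Let `(f̃, χ_ε)` be the Heegner pair associated to `E` … By replacing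
the appeal to (controlgo) (resp. (Hgstr), (IMC)) to (controlpo) (resp. (Hgstrpo), (IMCpo)) [=
Thms. 3.6.1, 3.3.4, 3.5.1], the rest of the proof is exactly the same as that in (pCgo)." Since
Thm. 3.5.1 is stated under "Case (I), i.e., `p ∤ N′`" — for an elliptic curve: `E` acquires good
ordinary reduction over an extension of degree `≤ 2`, semistability defect `e ≤ 2` (module
docstring) — THIS binder carries `W.HasGoodOrdinaryReductionOverQuadraticAt p` where the verbatim
binder `thm012_analyticRank_eq_of_selmerCorank_eq` (sibling file) carries the wider
`HasPotentiallyGoodOrdinaryReductionAtPrime`; the verbatim one implies this one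
(`thm371_caseOne_OPEN_of_thm012`); the difference (`e ∈ {3,4,6}`) is Q-B1 of OPEN-QUESTIONS-06.
Consumers on the (G-ord, `e = 2`) cells should cite THIS name. NEVER cite this `Prop` as a theorem.
[claim: KellerYin2024PotOrd, status: under-review] -/
def thm371_pConverse_caseOne_OPEN : Prop :=
  ∀ (W : WeierstrassCurve ℚ) [W.IsElliptic] (p : ℕ) [Fact p.Prime],
    2 < p → W.HasGoodOrdinaryReductionOverQuadraticAt p → Red W p →
      ∀ r : ℕ, r = 0 ∨ r = 1 → W.selmerCorank p = r → W.analyticRank = r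

/-- The verbatim binder of Thm. 0.1.2 (all potentially good ordinary `p > 2`) implies the
proof-scoped one (Case (I)), by `hasPotentiallyGoodOrdinaryReductionAtPrime_of_overQuadratic`.
Bookkeeping between two OPEN facts; nothing asserted. [claim: KellerYin2024PotOrd, status: under-review] -/
theorem thm371_caseOne_OPEN_of_thm012 (h : thm012_analyticRank_eq_of_selmerCorank_eq) :
    thm371_pConverse_caseOne_OPEN :=
  fun W _ p _ hp hcase hred r hr hcork ↦
    h W p hp (W.hasPotentiallyGoodOrdinaryReductionAtPrime_of_overQuadratic p hcase) hred r hr hcork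

end Literature.NumberTheory.EllipticCurves.KellerYin2024

end
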